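import Literature.NumberTheory.EllipticCurves.AnticyclotomicSignedLocalConditions
import Literature.NumberTheory.EllipticCurves.BurungaleKobayashiNakamuraOta2026.LocalBottomIndex
import HarnessLib

/-!
# The localisation map `loc_𝔭 : H¹_{𝓒}(K, 𝐓^ac) → H¹(K_𝔭, 𝐓^ac)` of Castella–Wan's Poitou–Tate
# sequences (6.12)–(6.13) on the tree's `Λ`-adic families, its `Λ^ac`-linearity, its kernel
# (the condition "strict at `𝔭`" in the sense `loc_𝔭 = 0`), and the generator bookkeeping
# `γ ↔ γ_v` between `Gal(K_∞/K)` and `Gal(K_{∞,w}/K_v)` — DEFINITIONS WITH BODIES, everything PROVED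

Topic `Literature/NumberTheory/EllipticCurves`; namespace `Literature.NumberTheory.EllipticCurves.AcSigned`
(third local file of the literature-typer seat `bsd-wall-utd-ty1`, generation 3, cell `pub/bsd-wall`,
`--supports` stmt-BirchSwinnertonDyer-23594 = crux `TwinSplitIMCAtThreeGoodSSApZero` of the route
`UniversalToricDescent`), continuing
`AnticyclotomicSignedCompactSelmer.lean` (the GLOBAL compact carriers `lambdaAdic W p κ γ C ⊆
∏_{n,m} H¹(K_n, E[p^m])`, `selmerLambdaAdic`, `lambdaAdic.moduleOfGen`) and
`AnticyclotomicSignedLocalConditions.lean` (the LOCAL carriers over `E = K_v`: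
`ZpExtension.localize`, `localLambdaAdic`, `localSignedLambdaAdic`, `localizeAt`, `IsNonsplitIn`).
HONEST FRAMING: this file introduces NO named fact and asserts nothing about any curve; it CONSTRUCTS
the map through which Castella–Wan's (6.12)–(6.15), Lemma 4.7, Cor. 6.4 and the "Howard frame" of
§6.3 are phrased, REUSING the tree's finite-level localisation
`WeierstrassCurve.localTorsionResOfEmb` (Burungale–Kobayashi–Nakamura–Ota cell, `LocalBottomIndex.lean`),
and PROVES its functoriality. Typed ≠ proved ≠ endorsed: BSD is not advanced by this file; the crux
(a PORT to `p = 3`, `a_3 = 0` of Castella–Wan Thm. A.5 + Thm. 6.8) stays open.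

## The printed statements being transcribed (Castella–Wan, Math. Ann. 389 (2024) = accepted MS)

* (3.10) and §4.1 (MS pp. 14, 19): "`H¹(K, 𝐓̃) ≃ lim←_n H¹(K[p^n], T)` given by Shapiro's lemma";
  `Λ^ac` identified "with the one variable power series ring `ℤ_p⟦Y⟧` setting `Y = γ^ac − 1`".
* (6.12) (MS p. 30 = journal p. 2624): "Global duality yields the following exact sequence
  `0 → Sel_{str,rel}(K, 𝐓^ac) → Sel_{±,rel}(K, 𝐓^ac) —loc_𝔭→ H¹_±(K_𝔭, 𝐓^ac) → X_{rel,str} → X_{±,str} → 0`."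
  (6.13): "`0 → Sel_{str,±}(K, 𝐓^ac) → Sel_±(K, 𝐓^ac) —loc_𝔭→ H¹_±(K_𝔭, 𝐓^ac) → X_{rel,±} → X_± → 0`";
  "Since `H¹(K, 𝐓^ac)` has trivial `Λ^ac`-torsion, the non-vanishing of `loc_𝔭` and the equality
  `rank_{Λ^ac}(Sel_±(K, 𝐓^ac)) = 1` implies that `Sel_{str,±}(K, 𝐓^ac) = 0`".
* Perrin-Riou 1987, §0 (pp. 400–402): `S_p(L) = lim←_k S(L)^{(p^k)} ⊂ ∏_k H¹(L, E[p^k])`, a compact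
  `ℤ_p`-module, functorial in `L` (the tree's model of every compact group here).

## What is typed, and how (SPECIAL CASE: one prime of `K_∞` above `v`; torsion coefficients)

Fix a field `K`, `W : WeierstrassCurve K`, a `ℤ_p`-extension `κ`, a field `E ⊇ K` with a `K`-embedding
`ι : K̄ → K̄_E` (intended: `E = K_v`, `ι = closureEmb`), and `h` = surjectivity of `κ ∘ res_ι`
(`IsNonsplitIn κ v`: EXACTLY ONE prime `w` of `K_∞` above `v`; then `H¹(K_v, 𝐓^ac) = lim←_n H¹(K_{n,w}, T)`
by Shapiro — in general the right-hand side of (6.12) is the SEMI-local sum over the `p^s` primes above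
`v`, flag `localize-nonsplit` of the sibling file).
* **(L1) finite level** — the tree's `W.localTorsionResOfEmb ι (p^m) (Gal(K̄/K_n))` IS
  `loc : H¹(K_n, E[p^m]) → H¹(K_{n,w}, E[p^m])` (compatible pair `(Γ_{K_{n,w}} → Γ_{K_n}, ι_*)`); this
  file adds its commutation with restriction (`localTorsionResOfEmb_resOfLe`) and with the conjugation
  actions (`localTorsionResOfEmb_conjH1`: `loc ∘ conj_{σ|K̄} = conj_σ ∘ loc`), both PROVED from
  `resH1Hom_comp` (the tree already proves the commutation with `p_*`,
  `localTorsionResOfEmb_reduceTorsionH1`, and with Kummer classes). Retyped over the localised tower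
  as `locLevel W p κ ι h n m : H¹(K_n, E[p^m]) →+ H¹((κ.localize ι h)-layer n, E_E[p^m])` (the SAME map;
  `(κ.localize ι h).layerSubgroup n = (Gal(K̄/K_n))_E` by `rfl`).
* **(L2) generators** — the global modules are built with a topological generator `γ ∈ Γ_K` of
  `Gal(K_∞/K)`, the local ones with `γ_E ∈ Γ_E`; under `h` every `γ` is matched by some `γ_E` with
  `κ(γ_E|K̄) = κ(γ)` (`exists_apply_resGalOfEmb_eq`), and EVERYTHING global depends on `γ` only through
  `κ γ` (inner automorphisms act trivially on cohomology, the tree's `conjH1_of_mem_holds`):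
  `conjH1_layer_eq_of_apply_eq`, `lambdaAdic_eq_of_apply_eq`, `tsmul_eq_of_apply_eq` (PROVED). So no
  generality is lost by asking `κ(γ_E|K̄) = κ γ`.
* **(L3) the map** — **`loc W p κ ι h γ γE hγE C : lambdaAdic W p κ γ C →+ localLambdaAdic W_E p κ_E γE`**,
  `(x_{n,m}) ↦ (loc x_{n,m})`: well defined because `loc` commutes with `p_*`, `res` and `conj`
  (`locPi_mem_localLambdaAdic`, PROVED), and **`Λ^ac`-LINEAR** for the two CONSTRUCTED module structures
  `lambdaAdic.moduleOfGen` / `localLambdaAdic.moduleOfGen` (`loc_smul`, PROVED by transport of the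
  truncated action, `map_evalT_id`). For `C = selmerTorsion L`: `locAt` on `selmerLambdaAdic W p κ γ L`
  = Castella–Wan's `loc_𝔭` of (6.12)/(6.13) restricted to `Sel^{𝓛}(K, 𝐓^ac)` (its values lie in the
  relaxed local module `H¹(K_v, 𝐓^ac)`; that the values on `Sel_ε` lie in `H¹_ε(K_v, 𝐓^ac)` =
  `localSignedLambdaAdic` is NOT proved here — it is the compatibility of the sibling files' two
  readings of `ℋ^ε` (global: Kummer image of `E^ε(K_∞·K_v)` inside `E(K̄_v)`; local: of
  `E_E^ε((K_v)_∞)` inside `E_E(K̄_v)`) along `localPointsEquivBaseChange`, flag `loc-image-signed`).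
* **(L4) the kernel** — `locKer W p κ ι h n m = ker(loc) ≤ H¹(K_n, E[p^m])`, PROVED `Γ_K`-stable
  (`conjH1_mem_locKer`, via (L2)), so that `lambdaAdic W p κ γ (C ⊓ locKer)` is again a module of the
  sibling construction; `loc_eq_zero_iff`, `mem_lambdaAdic_inf_locKer_iff`: the families in `Sel^{𝓒}`
  killed by `loc_𝔭` are exactly those satisfying `C ⊓ locKer` — the first three terms of (6.12)/(6.13)
  with `Sel_{str(𝔭),•} := ker loc_𝔭` IN CASTELLA–WAN'S SENSE. READING / flag `str-vs-loc-zero`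
  (recorded by the sibling Cor. 6.4 transfer file, `IsLocNonTorsionAt`): the tree's `PCond.str`
  (Greenberg's strict condition for `M⁺ = 0`: the image in `H¹(K_{∞,w}, E[p^∞])` vanishes, all
  conjugates) is a priori WEAKER at finite level than `locKer` (kernel of
  `H¹(K_{n,w}, E[p^m]) → H¹(K_{∞,w}, E[p^∞])`); the comparison of the two compact groups is not proved
  in this file.

## Main definitions and results (all `sorry`-free; no named fact; net debt 0)

* Part 1 (general `H ≤ Γ_K`): `localSubgroupOfEmb_mono`, `WeierstrassCurve.localTorsionResOfEmb_resOfLe`,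
  `WeierstrassCurve.localTorsionResOfEmb_conjH1`.
* Part 2 (generator bookkeeping, any field): `conjH1_layer_eq_of_apply_eq`, `conjPi_layer_eq_of_apply_eq`,
  `psi_eq_of_apply_eq`, `tsmul_eq_of_apply_eq`, `lambdaAdic_eq_of_apply_eq`,
  `exists_apply_resGalOfEmb_eq`, `isTopGenerator_localize_of_apply_eq`.
* Part 3 (the map): `locLevel` (+ `_apply`, `_reduceTorsionH1`, `_resOfLe`, `_conjH1`,
  `_conjH1_of_apply_eq`), `locPi` (+ `_apply`), `locPi_mem_localLambdaAdic`, **`loc`** (+ `loc_apply`),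
  **`loc_smul`**.
* Part 4 (the kernel): `locKer` (+ `mem_locKer_iff`, `conjH1_mem_locKer`, `inf_locKer_conjH1_mem`),
  `loc_eq_zero_iff`, `mem_lambdaAdic_inf_locKer_iff`, `loc_eq_zero_iff_mem`; Castella–Wan's Cor. 6.4 in
  kernel form with `str = ker loc_𝔭`: `IsLocNonTorsion` (+ `isLocNonTorsion_iff_loc`,
  `isLocNonTorsion_iff_smul_loc`).
* Part 5 (number fields, `E = K_v`, `ι = closureEmb`, `h : IsNonsplitIn κ v`): **`locAt`** (+ `locAt_apply`,
  `locAt_eq_zero_iff`) on `selmerLambdaAdic W p κ γ L`.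

## References

* [CastellaWan2023] F. Castella, X. Wan, *The Iwasawa main conjectures for GL₂ and derivatives of
  p-adic L-functions*, Math. Ann. 389 (2024) 2595–2636 = accepted MS: (3.10), §4.1 (MS pp. 14, 19),
  (6.12)–(6.13) and Lemma 6.7 (MS p. 30 = journal p. 2624).
* [PerrinRiou1987BSMF] B. Perrin-Riou, Bull. SMF 115 (1987), §0 pp. 400–402.
* [HatleyLeiVigni2022] J. Hatley, A. Lei, S. Vigni, arXiv:2003.10301, §3.1 (the local tower
  `K_{∞,v}/K_v`, Remark 3.1).
* [NeukirchSchmidtWingberg2008] J. Neukirch, A. Schmidt, K. Wingberg, *Cohomology of Number Fields*,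
  I.§5 (functoriality of `H¹`, conjugation), (1.6.3).
* [SerreLocalFields1979] J.-P. Serre, *Local Fields*, VII.§5 Prop. 3 (inner automorphisms act trivially).
* Tree: `BurungaleKobayashiNakamuraOta2026/LocalBottomIndex.lean` (`localTorsionResOfEmb`, reused),
  `SubgroupSelmer.lean` (`resH1Hom_comp`, `conjH1_mul_holds`), `IwasawaSelmerProofs.lean`
  (`conjH1_of_mem_holds`).
-/

noncomputable section

open scoped Classical

open NumberField IsDedekindDomain Field
open Literature.NumberTheory.EllipticCurves Literature.NumberTheory.GaloisRepresentations
open Literature.NumberTheory.EllipticCurves.IwasawaDual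
open WeierstrassCurve (geomTorsion geomPoints)
open WeierstrassCurve.LambdaAdicSelmerDataExists

universe u

/-! ## Part 1. Functoriality of the finite-level localisation `loc_ι` (general `H ≤ Γ_K`) -/

namespace Literature.NumberTheory.EllipticCurves

variable {K : Type u} [Field K] {E : Type u} [Field E] [Algebra K E]
  (ι : AlgebraicClosure K →ₐ[K] AlgebraicClosure E)

/-- `H ↦ H_E = res_ι⁻¹(H)` is monotone (preimages are monotone). Serre, *Galois Cohomology*, II.§1.1
(restriction to the decomposition group). [cite: SerreGaloisCohomology1997, II.§1.1] -/
theorem localSubgroupOfEmb_mono {H H' : Subgroup (absoluteGaloisGroup K)} (h : H ≤ H') :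
    localSubgroupOfEmb H ι ≤ localSubgroupOfEmb H' ι :=
  fun _ hτ ↦ h hτ

end Literature.NumberTheory.EllipticCurves

namespace WeierstrassCurve

variable {K : Type u} [Field K] (W : WeierstrassCurve K)
variable {E : Type u} [Field E] [Algebra K E] (ι : AlgebraicClosure K →ₐ[K] AlgebraicClosure E)

/-- **`loc_ι` commutes with restriction**: for `H ≤ H'` (fields `L' ⊆ L`),
`loc_ι ∘ res_{L'→L} = res_{L'_E → L_E} ∘ loc_ι` on `H¹(·, E[m])` — both composites are the map of
the compatible pair `(H_E → H', ι_*)` (`resH1Hom_comp`). Neukirch–Schmidt–Wingberg I.§5.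
[cite: NeukirchSchmidtWingberg2008, I.§5] -/
theorem localTorsionResOfEmb_resOfLe (m : ℤ) {H H' : Subgroup (absoluteGaloisGroup K)} (hH : H ≤ H')
    (x : W.torsionH1Over m H') :
    W.localTorsionResOfEmb ι m H
        (Literature.NumberTheory.EllipticCurves.resOfLe (geomTorsion W m) hH x) =
      Literature.NumberTheory.EllipticCurves.resOfLe (geomTorsion (W.baseChange E) m)
        (localSubgroupOfEmb_mono ι hH) (W.localTorsionResOfEmb ι m H' x) := by
  change ((W.localTorsionResOfEmb ι m H).comp
      (Literature.NumberTheory.EllipticCurves.resOfLe (geomTorsion W m) hH)) x =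
    ((Literature.NumberTheory.EllipticCurves.resOfLe (geomTorsion (W.baseChange E) m)
      (localSubgroupOfEmb_mono ι hH)).comp (W.localTorsionResOfEmb ι m H')) x
  rw [localTorsionResOfEmb, localTorsionResOfEmb, Literature.NumberTheory.EllipticCurves.resOfLe,
    Literature.NumberTheory.EllipticCurves.resOfLe, resH1Hom_comp, resH1Hom_comp]
  exact DFunLike.congr_fun (resH1Hom_congr (by ext; rfl) (by ext; rfl) _ _) x

/-- **`loc_ι` intertwines the conjugation actions**: for `H ⊴ Γ_K` (so `H_E ⊴ Γ_E`) and `σ ∈ Γ_E`,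
`loc_ι ∘ conj_{σ|_{K̄}} = conj_σ ∘ loc_ι` on `H¹(H, E[m]) → H¹(H_E, E_E[m])` — both composites are
the map of the compatible pair `(τ ↦ σ|⁻¹ τ| σ|, P ↦ σ • ι_* P)` (`resH1Hom_comp`, equivariance
`geomPointsMapOfEmb_smul`). This is the compatibility of `loc_𝔭` with the `Gal(K_n/K)`- and
`Gal(K_{n,w}/K_v)`-actions making it `Λ^ac`-linear (Castella–Wan §4.1).
[cite: NeukirchSchmidtWingberg2008, I.§5] [cite: CastellaWan2023, §4.1 (MS p. 19)] -/
theorem localTorsionResOfEmb_conjH1 (m : ℤ) (H : Subgroup (absoluteGaloisGroup K)) [H.Normal]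
    [hE : (localSubgroupOfEmb H ι).Normal] (σ : absoluteGaloisGroup E) (x : W.torsionH1Over m H) :
    W.localTorsionResOfEmb ι m H
        (Literature.NumberTheory.EllipticCurves.conjH1 H (geomTorsion W m) (resGalOfEmb ι σ) x) =
      Literature.NumberTheory.EllipticCurves.conjH1 (localSubgroupOfEmb H ι)
        (geomTorsion (W.baseChange E) m) σ (W.localTorsionResOfEmb ι m H x) := by
  change ((W.localTorsionResOfEmb ι m H).comp
      (Literature.NumberTheory.EllipticCurves.conjH1 H (geomTorsion W m) (resGalOfEmb ι σ))) x =
    ((Literature.NumberTheory.EllipticCurves.conjH1 (localSubgroupOfEmb H ι)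
      (geomTorsion (W.baseChange E) m) σ).comp (W.localTorsionResOfEmb ι m H)) x
  rw [localTorsionResOfEmb, Literature.NumberTheory.EllipticCurves.conjH1,
    Literature.NumberTheory.EllipticCurves.conjH1, resH1Hom_comp, resH1Hom_comp]
  congr 1
  refine resH1Hom_congr ?_ ?_ _ _
  · refine ContinuousMonoidHom.ext fun τ ↦ Subtype.ext ?_
    change (resGalOfEmb ι σ)⁻¹ * resGalOfEmb ι (τ : absoluteGaloisGroup E) * resGalOfEmb ι σ =
      resGalOfEmb ι (σ⁻¹ * (τ : absoluteGaloisGroup E) * σ)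
    rw [map_mul, map_mul, map_inv]
  · ext P
    change W.geomPointsMapOfEmb ι (resGalOfEmb ι σ • (P : W.geomPoints)) =
      σ • W.geomPointsMapOfEmb ι (P : W.geomPoints)
    exact W.geomPointsMapOfEmb_smul ι σ P

end WeierstrassCurve

namespace Literature.NumberTheory.EllipticCurves

namespace AcSigned

/-! ## Part 2. Generator bookkeeping: everything depends on `γ` only through `κ γ` -/

section Generators

variable {K : Type u} [Field K] (W : WeierstrassCurve K) (p : ℕ) [Fact p.Prime]
  (κ : ZpExtension K p)

/-- **Inner automorphisms act trivially**: if `κ γ = κ γ'` (i.e. `γ'⁻¹γ ∈ Gal(K̄/K_∞) ≤ Gal(K̄/K_n)`),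
then `conj_γ = conj_{γ'}` on `H¹(K_n, E[p^m])` (`conjH1_mul_holds` + `conjH1_of_mem_holds`). Serre,
*Local Fields* VII.§5 Prop. 3; Neukirch–Schmidt–Wingberg (1.6.3). [cite: SerreLocalFields1979, VII.§5 Prop. 3] -/
theorem conjH1_layer_eq_of_apply_eq {γ γ' : absoluteGaloisGroup K} (hγ : κ γ = κ γ') (n m : ℕ) :
    conjH1 (κ.layerSubgroup n) (geomTorsion W ((p : ℤ) ^ m)) γ =
      conjH1 (κ.layerSubgroup n) (geomTorsion W ((p : ℤ) ^ m)) γ' := by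
  have hmem : γ'⁻¹ * γ ∈ κ.layerSubgroup n := κ.kerSubgroup_le_layerSubgroup n (by
    rw [ZpExtension.mem_kerSubgroup, map_mul, map_inv, hγ, inv_mul_cancel])
  have hγeq : γ' * (γ'⁻¹ * γ) = γ := mul_inv_cancel_left γ' γ
  rw [← hγeq, conjH1_mul_holds (κ.layerSubgroup n) (geomTorsion W ((p : ℤ) ^ m)) γ' (γ'⁻¹ * γ),
    conjH1_of_mem_holds _ _ hmem, AddMonoidHom.comp_id]

/-- The same for the componentwise conjugation `conjPi` on `∏_m H¹(K_n, E[p^m])`.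
[cite: SerreLocalFields1979, VII.§5 Prop. 3] -/
theorem conjPi_layer_eq_of_apply_eq {γ γ' : absoluteGaloisGroup K} (hγ : κ γ = κ γ') (n : ℕ) :
    W.conjPi p (κ.layerSubgroup n) γ = W.conjPi p (κ.layerSubgroup n) γ' := by
  refine AddMonoidHom.ext fun x ↦ funext fun k ↦ ?_
  simp only [WeierstrassCurve.conjPi, AddMonoidHom.pi_apply, AddMonoidHom.coe_comp,
    Function.comp_apply, Pi.evalAddMonoidHom_apply]
  rw [conjH1_layer_eq_of_apply_eq W p κ hγ]

/-- The operator `ψ = conj_γ − 1` through which `T` acts depends only on `κ γ`.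
[cite: CastellaWan2023, §4.1 (MS p. 19, "`Y = γ^ac − 1`")] -/
theorem psi_eq_of_apply_eq {γ γ' : absoluteGaloisGroup K} (hγ : κ γ = κ γ') (n m : ℕ) :
    psi W p κ γ n m = psi W p κ γ' n m := by
  unfold psi
  rw [conjH1_layer_eq_of_apply_eq W p κ hγ]

/-- The truncated `ℤ_p⟦T⟧`-action `tsmul` depends only on `κ γ`. [cite: CastellaWan2023, §4.1 (MS p. 19)] -/
theorem tsmul_eq_of_apply_eq {γ γ' : absoluteGaloisGroup K} (hγ : κ γ = κ γ') (f : IwasawaAlgebra p)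
    (x : Π n m : ℕ, W.torsionH1Over ((p : ℤ) ^ m) (κ.layerSubgroup n)) :
    tsmul W p κ γ f x = tsmul W p κ γ' f x := by
  funext n m
  unfold tsmul
  rw [psi_eq_of_apply_eq W p κ hγ]

/-- **The `Λ`-adic families depend on `γ` only through `κ γ`**: the norm relation
`res x_n = Σ_{i<p} conj_{γ^{pⁿ i}} x_{n+1}` is unchanged when `γ` is replaced by `γ'` with
`κ γ = κ γ'` (so `κ (γ^k) = κ (γ'^k)`). [cite: PerrinRiou1987BSMF, §0 p. 402] -/
theorem lambdaAdic_eq_of_apply_eq {γ γ' : absoluteGaloisGroup K} (hγ : κ γ = κ γ')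
    (C : ∀ n m : ℕ, AddSubgroup (W.torsionH1Over ((p : ℤ) ^ m) (κ.layerSubgroup n))) :
    lambdaAdic W p κ γ C = lambdaAdic W p κ γ' C := by
  have hconj : ∀ (n k : ℕ), W.conjPi p (κ.layerSubgroup n) (γ ^ k) =
      W.conjPi p (κ.layerSubgroup n) (γ' ^ k) :=
    fun n k ↦ conjPi_layer_eq_of_apply_eq W p κ (by rw [map_pow, map_pow, hγ]) n
  ext x
  simp only [mem_lambdaAdic_iff, hconj]

variable {E : Type u} [Field E] [Algebra K E] (ι : AlgebraicClosure K →ₐ[K] AlgebraicClosure E)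
  (h : Function.Surjective (κ.toContinuousMonoidHom.comp (resGalOfEmb ι)))

/-- **Every `γ ∈ Γ_K` is matched by some `γ_E ∈ Γ_E` with `κ(γ_E|_{K̄}) = κ γ`** — this is exactly
the surjectivity `h` of `κ ∘ res_ι` (one prime of `K_∞` above the place: `Gal(K_{∞,w}/K_v) = Gal(K_∞/K)`).
Hatley–Lei–Vigni §3.1. [cite: HatleyLeiVigni2022, §3.1] -/
theorem exists_apply_resGalOfEmb_eq
    (h : Function.Surjective (κ.toContinuousMonoidHom.comp (resGalOfEmb ι))) (γ : absoluteGaloisGroup K) :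
    ∃ γE : absoluteGaloisGroup E, κ (resGalOfEmb ι γE) = κ γ :=
  h (κ γ)

/-- If `κ(γ_E|_{K̄}) = κ γ` and `γ` is a topological generator of `Gal(K_∞/K)`, then `γ_E` is a
topological generator of the localised extension `Gal(K_{∞,w}/K_v)`. [cite: HatleyLeiVigni2022, §3.1] -/
theorem isTopGenerator_localize_of_apply_eq {γ : absoluteGaloisGroup K} {γE : absoluteGaloisGroup E}
    (hγE : κ (resGalOfEmb ι γE) = κ γ) (hγ : κ.IsTopGenerator γ) :
    (κ.localize ι h).IsTopGenerator γE := by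
  rw [ZpExtension.isTopGenerator_localize_iff]
  change κ (resGalOfEmb ι γE) = _
  rw [hγE]
  exact hγ

end Generators

/-! ## Part 3. The localisation map on `Λ`-adic families -/

section Loc

variable {K : Type u} [Field K] (W : WeierstrassCurve K) (p : ℕ) [Fact p.Prime]
  (κ : ZpExtension K p) {E : Type u} [Field E] [Algebra K E]
  (ι : AlgebraicClosure K →ₐ[K] AlgebraicClosure E)
  (h : Function.Surjective (κ.toContinuousMonoidHom.comp (resGalOfEmb ι)))

/-- **`loc : H¹(K_n, E[p^m]) → H¹(K_{n,w}, E_E[p^m])` at level `(n, m)` of the towers** — the tree's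
`W.localTorsionResOfEmb ι (p^m) (Gal(K̄/K_n))` (map of the compatible pair `(Γ_{K_{n,w}} → Γ_{K_n}, ι_*)`),
with its target READ over the localised `ℤ_p`-extension `κ.localize ι h` (the same type:
`(κ.localize ι h).layerSubgroup n = (Gal(K̄/K_n))_E` by `rfl`, sibling `layerSubgroup_localize`).
The level-`(n, m)` component of Castella–Wan's `loc_𝔭` ((6.12); Shapiro (3.10)).
[cite: CastellaWan2023, (6.12) (MS p. 30 = journal p. 2624)] [cite: PerrinRiou1987BSMF, §0 p. 401] -/
def locLevel (n m : ℕ) :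
    W.torsionH1Over ((p : ℤ) ^ m) (κ.layerSubgroup n) →+
      (W.baseChange E).torsionH1Over ((p : ℤ) ^ m) ((κ.localize ι h).layerSubgroup n) :=
  W.localTorsionResOfEmb ι ((p : ℤ) ^ m) (κ.layerSubgroup n)

/-- `locLevel` IS the tree's `localTorsionResOfEmb` (definitional). [cite: PerrinRiou1987BSMF, §0 p. 401] -/
theorem locLevel_apply (n m : ℕ) (x : W.torsionH1Over ((p : ℤ) ^ m) (κ.layerSubgroup n)) :
    locLevel W p κ ι h n m x = W.localTorsionResOfEmb ι ((p : ℤ) ^ m) (κ.layerSubgroup n) x :=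
  rfl

/-- `loc ∘ p_* = p_* ∘ loc` (the tree's `localTorsionResOfEmb_reduceTorsionH1`, retyped).
[cite: PerrinRiou1987BSMF, §0 p. 401] -/
theorem locLevel_reduceTorsionH1 (n m : ℕ)
    (x : W.torsionH1Over ((p : ℤ) ^ (m + 1)) (κ.layerSubgroup n)) :
    locLevel W p κ ι h n m (W.reduceTorsionH1 p m (κ.layerSubgroup n) x) =
      (W.baseChange E).reduceTorsionH1 p m ((κ.localize ι h).layerSubgroup n)
        (locLevel W p κ ι h n (m + 1) x) :=
  W.localTorsionResOfEmb_reduceTorsionH1 ι p m (κ.layerSubgroup n) x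

/-- `loc ∘ res_{K_n → K_{n'}} = res_{K_{n,w} → K_{n',w}} ∘ loc` (`localTorsionResOfEmb_resOfLe`, retyped).
[cite: NeukirchSchmidtWingberg2008, I.§5] -/
theorem locLevel_resOfLe {n n' : ℕ} (hn : n ≤ n') (m : ℕ)
    (x : W.torsionH1Over ((p : ℤ) ^ m) (κ.layerSubgroup n)) :
    locLevel W p κ ι h n' m (resOfLe (geomTorsion W ((p : ℤ) ^ m)) (κ.layerSubgroup_antitone hn) x) =
      resOfLe (geomTorsion (W.baseChange E) ((p : ℤ) ^ m))
        ((κ.localize ι h).layerSubgroup_antitone hn) (locLevel W p κ ι h n m x) :=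
  W.localTorsionResOfEmb_resOfLe ι ((p : ℤ) ^ m) (κ.layerSubgroup_antitone hn) x

/-- `loc ∘ conj_{σ|_{K̄}} = conj_σ ∘ loc` for `σ ∈ Γ_E` (`localTorsionResOfEmb_conjH1`, retyped).
[cite: NeukirchSchmidtWingberg2008, I.§5] [cite: CastellaWan2023, §4.1 (MS p. 19)] -/
theorem locLevel_conjH1 (n m : ℕ) (σ : absoluteGaloisGroup E)
    (x : W.torsionH1Over ((p : ℤ) ^ m) (κ.layerSubgroup n)) :
    locLevel W p κ ι h n m
        (conjH1 (κ.layerSubgroup n) (geomTorsion W ((p : ℤ) ^ m)) (resGalOfEmb ι σ) x) =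
      conjH1 ((κ.localize ι h).layerSubgroup n) (geomTorsion (W.baseChange E) ((p : ℤ) ^ m)) σ
        (locLevel W p κ ι h n m x) :=
  W.localTorsionResOfEmb_conjH1 ι ((p : ℤ) ^ m) (κ.layerSubgroup n)
    (hE := ZpExtension.layerSubgroup_normal (κ.localize ι h) n) σ x

/-- `loc ∘ conj_σ = conj_{σ_E} ∘ loc` for ANY `σ ∈ Γ_K` and any `σ_E ∈ Γ_E` with `κ(σ_E|_{K̄}) = κ σ`
(Part 2: `conj_σ = conj_{σ_E|_{K̄}}` on `H¹(K_n, ·)`). [cite: NeukirchSchmidtWingberg2008, I.§5 and (1.6.3)] -/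
theorem locLevel_conjH1_of_apply_eq (n m : ℕ) {σ : absoluteGaloisGroup K} {σE : absoluteGaloisGroup E}
    (hσ : κ (resGalOfEmb ι σE) = κ σ) (x : W.torsionH1Over ((p : ℤ) ^ m) (κ.layerSubgroup n)) :
    locLevel W p κ ι h n m (conjH1 (κ.layerSubgroup n) (geomTorsion W ((p : ℤ) ^ m)) σ x) =
      conjH1 ((κ.localize ι h).layerSubgroup n) (geomTorsion (W.baseChange E) ((p : ℤ) ^ m)) σE
        (locLevel W p κ ι h n m x) := by
  rw [← conjH1_layer_eq_of_apply_eq W p κ hσ n m]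
  exact locLevel_conjH1 W p κ ι h n m σE x

/-- `loc` on doubly-indexed families: `(x_{n,m}) ↦ (loc x_{n,m})`, an additive homomorphism
`∏_{n,m} H¹(K_n, E[p^m]) → ∏_{n,m} H¹(K_{n,w}, E_E[p^m])`. [cite: PerrinRiou1987BSMF, §0 p. 401] -/
def locPi : (Π n m : ℕ, W.torsionH1Over ((p : ℤ) ^ m) (κ.layerSubgroup n)) →+
    Π n m : ℕ, (W.baseChange E).torsionH1Over ((p : ℤ) ^ m) ((κ.localize ι h).layerSubgroup n) :=
  AddMonoidHom.pi fun n ↦ AddMonoidHom.pi fun m ↦ (locLevel W p κ ι h n m).comp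
    ((Pi.evalAddMonoidHom (fun j : ℕ ↦ W.torsionH1Over ((p : ℤ) ^ j) (κ.layerSubgroup n)) m).comp
      (Pi.evalAddMonoidHom (fun j : ℕ ↦ Π m : ℕ, W.torsionH1Over ((p : ℤ) ^ m) (κ.layerSubgroup j)) n))

/-- Components of `locPi`. [cite: PerrinRiou1987BSMF, §0 p. 401] -/
@[simp]
theorem locPi_apply (x : Π n m : ℕ, W.torsionH1Over ((p : ℤ) ^ m) (κ.layerSubgroup n)) (n m : ℕ) :
    locPi W p κ ι h x n m = locLevel W p κ ι h n m (x n m) :=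
  rfl

/-- **`loc` maps `Λ`-adic families to local `Λ`-adic families**: for `γ ∈ Γ_K` and `γ_E ∈ Γ_E` with
`κ(γ_E|_{K̄}) = κ γ`, a family `x ∈ lambdaAdic W p κ γ C` (`x_{n,m} ∈ C n m`, `p_*`-compatible,
norm-compatible for `γ`) has `loc x` `p_*`-compatible and norm-compatible for `γ_E` (no condition on
the local side: the relaxed local module `localLambdaAdic` = `H¹(K_v, 𝐓^ac)`), because `loc`
commutes with `p_*`, `res` and `conj` (Parts 1–2). This is the statement that `loc_𝔭` is defined on
`H¹(K, 𝐓^ac) = lim← H¹(K_n, T)` with values in `H¹(K_𝔭, 𝐓^ac) = lim← H¹(K_{n,w}, T)` (Castella–Wan (6.12),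
Shapiro (3.10)). [cite: CastellaWan2023, (3.10) and (6.12) (MS pp. 14, 30)] [cite: PerrinRiou1987BSMF, §0 p. 402] -/
theorem locPi_mem_localLambdaAdic {γ : absoluteGaloisGroup K} {γE : absoluteGaloisGroup E}
    (hγE : κ (resGalOfEmb ι γE) = κ γ)
    {C : ∀ n m : ℕ, AddSubgroup (W.torsionH1Over ((p : ℤ) ^ m) (κ.layerSubgroup n))}
    {x : Π n m : ℕ, W.torsionH1Over ((p : ℤ) ^ m) (κ.layerSubgroup n)}
    (hx : x ∈ lambdaAdic W p κ γ C) :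
    locPi W p κ ι h x ∈ localLambdaAdic (W.baseChange E) p (κ.localize ι h) γE := by
  rw [← lambdaAdic_eq_of_apply_eq W p κ hγE C, mem_lambdaAdic_iff] at hx
  refine ⟨fun _ _ ↦ AddSubgroup.mem_top _, fun n m ↦ ?_, fun n ↦ ?_⟩
  · rw [locPi_apply, locPi_apply, ← hx.2.1 n m]
    exact (locLevel_reduceTorsionH1 W p κ ι h n m (x n (m + 1))).symm
  · funext m
    have h1 := congrFun (hx.2.2 n) m
    simp only [WeierstrassCurve.resPi, WeierstrassCurve.conjPi, AddMonoidHom.pi_apply,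
      AddMonoidHom.coe_comp, Function.comp_apply, Pi.evalAddMonoidHom_apply, Finset.sum_apply] at h1 ⊢
    rw [locPi_apply, locPi_apply, ← locLevel_resOfLe W p κ ι h (Nat.le_succ n) m, h1, map_sum]
    refine Finset.sum_congr rfl fun i _ ↦ ?_
    rw [← map_pow]
    exact locLevel_conjH1 W p κ ι h (n + 1) m (γE ^ (p ^ n * i)) _

/-- **The localisation map `loc : lim←_n H¹_{𝓒}(K_n, T) → H¹(K_v, 𝐓^ac) = lim←_n H¹(K_{n,w}, T)` on the
tree's `Λ`-adic families** (Castella–Wan's `loc_𝔭` of (6.12)/(6.13) for `E = K_𝔭`, `ι = closureEmb`,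
restricted to the families satisfying the level conditions `C`): `x ↦ (loc x_{n,m})_{n,m}`
(`locPi`, corestricted by `locPi_mem_localLambdaAdic`). Parameters: `γ ∈ Γ_K` (the generator used
for the global module), `γ_E ∈ Γ_E` with `hγE : κ(γ_E|_{K̄}) = κ γ` (the matching local generator,
which exists by `exists_apply_resGalOfEmb_eq`). [cite: CastellaWan2023, (6.12)–(6.13) (MS p. 30 = journal p. 2624)] -/
def loc (γ : absoluteGaloisGroup K) (γE : absoluteGaloisGroup E) (hγE : κ (resGalOfEmb ι γE) = κ γ)
    (C : ∀ n m : ℕ, AddSubgroup (W.torsionH1Over ((p : ℤ) ^ m) (κ.layerSubgroup n))) :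
    lambdaAdic W p κ γ C →+ localLambdaAdic (W.baseChange E) p (κ.localize ι h) γE :=
  ((locPi W p κ ι h).comp (lambdaAdic W p κ γ C).subtype).codRestrict _
    fun x ↦ locPi_mem_localLambdaAdic W p κ ι h hγE x.2

/-- Components of `loc`: `(loc x)_{n,m} = loc_{n,m} x_{n,m}`. [cite: CastellaWan2023, (6.12) (MS p. 30)] -/
theorem loc_apply {γ : absoluteGaloisGroup K} {γE : absoluteGaloisGroup E}
    (hγE : κ (resGalOfEmb ι γE) = κ γ)
    (C : ∀ n m : ℕ, AddSubgroup (W.torsionH1Over ((p : ℤ) ^ m) (κ.layerSubgroup n)))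
    (x : lambdaAdic W p κ γ C) (n m : ℕ) :
    (loc W p κ ι h γ γE hγE C x).1 n m = locLevel W p κ ι h n m (x.1 n m) :=
  rfl

/-- **`loc` is `Λ^ac = ℤ_p⟦T⟧`-linear** for the CONSTRUCTED module structures of the sibling files
(`lambdaAdic.moduleOfGen hγ hC` on the source, `T ↦ conj_γ − 1` truncated; `localLambdaAdic.moduleOfGen`
on the target, `T ↦ conj_{γ_E} − 1`), because `loc` intertwines `conj_γ − 1` and `conj_{γ_E} − 1`
(`locLevel_conjH1_of_apply_eq`) and the truncated action is transported along any such map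
(`map_evalT_id`). Castella–Wan §4.1: the `Λ^ac`-module structures on `H¹(K, 𝐓^ac)`, `H¹(K_𝔭, 𝐓^ac)`
through `Y = γ^ac − 1`; (6.12) is a sequence of `Λ^ac`-modules.
[cite: CastellaWan2023, §4.1 and (6.12) (MS pp. 19, 30)] [cite: Lang1990, Ch. 5 §1 Thm. 1.1] -/
theorem loc_smul {γ : absoluteGaloisGroup K} {γE : absoluteGaloisGroup E}
    (hγE : κ (resGalOfEmb ι γE) = κ γ) (hγ : κ.IsTopGenerator γ)
    {C : ∀ n m : ℕ, AddSubgroup (W.torsionH1Over ((p : ℤ) ^ m) (κ.layerSubgroup n))}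
    (hC : ∀ n m, ∀ y ∈ C n m, conjH1 (κ.layerSubgroup n) (geomTorsion W ((p : ℤ) ^ m)) γ y ∈ C n m)
    (f : IwasawaAlgebra p) (x : lambdaAdic W p κ γ C) :
    letI := lambdaAdic.moduleOfGen hγ hC
    letI := localLambdaAdic.moduleOfGen (W.baseChange E) p (κ.localize ι h) γE
      (isTopGenerator_localize_of_apply_eq p κ ι h hγE hγ)
    loc W p κ ι h γ γE hγE C (f • x) = f • loc W p κ ι h γ γE hγE C x := by
  refine Subtype.ext (funext fun n ↦ funext fun m ↦ ?_)
  rw [loc_apply, lambdaAdic.smul_apply, psi_eq_of_apply_eq W p κ hγE.symm n m]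
  change _ = evalT p (psi (W.baseChange E) p (κ.localize ι h) γE n m) (m * p ^ n) m f
    (AddMonoidHom.id _) ((loc W p κ ι h γ γE hγE C x).1 n m)
  rw [loc_apply]
  exact map_evalT_id _ _ (locLevel W p κ ι h n m)
    (fun a ↦ by rw [psi_apply, psi_apply, map_sub, locLevel_conjH1]) _ _ f _

/-! ## Part 4. The kernel of `loc`: "strict at the place of `ι`" in the sense `loc = 0` -/

/-- **`locKer n m = ker(loc : H¹(K_n, E[p^m]) → H¹(K_{n,w}, E_E[p^m]))`**, the level-`(n, m)`
condition "strict at the place singled out by `ι`" in Castella–Wan's sense `Sel_{str,•} = ker loc_𝔭`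
((6.12)–(6.13)). READING (flag `str-vs-loc-zero`): a priori STRONGER at finite level than the tree's
`PCond.str` (image in `H¹(K_{∞,w}, E[p^∞])` vanishes); the comparison of the compact groups is not
proved here. [cite: CastellaWan2023, (6.12)–(6.13) (MS p. 30 = journal p. 2624)] -/
def locKer (n m : ℕ) : AddSubgroup (W.torsionH1Over ((p : ℤ) ^ m) (κ.layerSubgroup n)) :=
  (locLevel W p κ ι h n m).ker

/-- Membership in `locKer` (unfolding). [cite: CastellaWan2023, (6.12) (MS p. 30)] -/
theorem mem_locKer_iff (n m : ℕ) (y : W.torsionH1Over ((p : ℤ) ^ m) (κ.layerSubgroup n)) :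
    y ∈ locKer W p κ ι h n m ↔ locLevel W p κ ι h n m y = 0 :=
  Iff.rfl

/-- **`locKer` is stable under the conjugation action of ALL of `Γ_K`** (so it is an admissible level
condition for `lambdaAdic.moduleOfGen` with ANY generator): for `σ ∈ Γ_K` pick `σ_E` with
`κ(σ_E|_{K̄}) = κ σ` (`h`); then `loc (conj_σ y) = conj_{σ_E} (loc y) = 0`.
[cite: CastellaWan2023, §4.1 and (6.12) (MS pp. 19, 30)] -/
theorem conjH1_mem_locKer (n m : ℕ) (σ : absoluteGaloisGroup K)
    {y : W.torsionH1Over ((p : ℤ) ^ m) (κ.layerSubgroup n)} (hy : y ∈ locKer W p κ ι h n m) :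
    conjH1 (κ.layerSubgroup n) (geomTorsion W ((p : ℤ) ^ m)) σ y ∈ locKer W p κ ι h n m := by
  obtain ⟨σE, hσE⟩ := exists_apply_resGalOfEmb_eq p κ ι h σ
  rw [mem_locKer_iff, locLevel_conjH1_of_apply_eq W p κ ι h n m hσE, (mem_locKer_iff W p κ ι h n m y).1 hy,
    map_zero]

/-- The level conditions `C ⊓ locKer` are `conj_γ`-stable when `C` is (hypothesis shape of
`lambdaAdic.moduleOfGen`). [cite: CastellaWan2023, §4.1 (MS p. 19)] -/
theorem inf_locKer_conjH1_mem {γ : absoluteGaloisGroup K}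
    {C : ∀ n m : ℕ, AddSubgroup (W.torsionH1Over ((p : ℤ) ^ m) (κ.layerSubgroup n))}
    (hC : ∀ n m, ∀ y ∈ C n m, conjH1 (κ.layerSubgroup n) (geomTorsion W ((p : ℤ) ^ m)) γ y ∈ C n m) :
    ∀ n m, ∀ y ∈ C n m ⊓ locKer W p κ ι h n m,
      conjH1 (κ.layerSubgroup n) (geomTorsion W ((p : ℤ) ^ m)) γ y ∈ C n m ⊓ locKer W p κ ι h n m :=
  fun n m _ hy ↦ ⟨hC n m _ hy.1, conjH1_mem_locKer W p κ ι h n m γ hy.2⟩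

/-- **`loc x = 0 ↔` every component of `x` lies in `locKer`.** [cite: CastellaWan2023, (6.12)–(6.13) (MS p. 30)] -/
theorem loc_eq_zero_iff {γ : absoluteGaloisGroup K} {γE : absoluteGaloisGroup E}
    (hγE : κ (resGalOfEmb ι γE) = κ γ)
    (C : ∀ n m : ℕ, AddSubgroup (W.torsionH1Over ((p : ℤ) ^ m) (κ.layerSubgroup n)))
    (x : lambdaAdic W p κ γ C) :
    loc W p κ ι h γ γE hγE C x = 0 ↔ ∀ n m, x.1 n m ∈ locKer W p κ ι h n m := by
  constructor
  · intro h0 n m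
    have h1 := congrFun (congrFun (congrArg Subtype.val h0) n) m
    rw [loc_apply] at h1
    exact h1
  · intro hall
    exact Subtype.ext (funext fun n ↦ funext fun m ↦ by rw [loc_apply]; exact hall n m)

/-- **`ker(loc_𝔭 | Sel^{𝓒}) = Sel^{𝓒 ⊓ str(𝔭)}`**: a family satisfies the conditions `C ⊓ locKer` iff it
satisfies `C` and is killed by `loc` — the first three terms of (6.12)/(6.13),
`0 → Sel_{str,•}(K, 𝐓^ac) → Sel_{•}(K, 𝐓^ac) —loc_𝔭→ H¹(K_𝔭, 𝐓^ac)`, with `str` in Castella–Wan's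
sense `ker loc_𝔭`. [cite: CastellaWan2023, (6.12)–(6.13) (MS p. 30 = journal p. 2624)] -/
theorem mem_lambdaAdic_inf_locKer_iff {γ : absoluteGaloisGroup K}
    (C : ∀ n m : ℕ, AddSubgroup (W.torsionH1Over ((p : ℤ) ^ m) (κ.layerSubgroup n)))
    (x : Π n m : ℕ, W.torsionH1Over ((p : ℤ) ^ m) (κ.layerSubgroup n)) :
    x ∈ lambdaAdic W p κ γ (fun n m ↦ C n m ⊓ locKer W p κ ι h n m) ↔
      x ∈ lambdaAdic W p κ γ C ∧ ∀ n m, x n m ∈ locKer W p κ ι h n m := by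
  constructor
  · rintro ⟨h1, h2, h3⟩
    exact ⟨⟨fun n m ↦ (h1 n m).1, h2, h3⟩, fun n m ↦ (h1 n m).2⟩
  · rintro ⟨⟨h1, h2, h3⟩, h4⟩
    exact ⟨fun n m ↦ ⟨h1 n m, h4 n m⟩, h2, h3⟩

/-- For `x ∈ Sel^{𝓒}`: `loc x = 0 ↔ x ∈ Sel^{𝓒 ⊓ str(ι)}`. [cite: CastellaWan2023, (6.12)–(6.13) (MS p. 30)] -/
theorem loc_eq_zero_iff_mem {γ : absoluteGaloisGroup K} {γE : absoluteGaloisGroup E}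
    (hγE : κ (resGalOfEmb ι γE) = κ γ)
    (C : ∀ n m : ℕ, AddSubgroup (W.torsionH1Over ((p : ℤ) ^ m) (κ.layerSubgroup n)))
    (x : lambdaAdic W p κ γ C) :
    loc W p κ ι h γ γE hγE C x = 0 ↔
      x.1 ∈ lambdaAdic W p κ γ (fun n m ↦ C n m ⊓ locKer W p κ ι h n m) := by
  rw [loc_eq_zero_iff, mem_lambdaAdic_inf_locKer_iff]
  exact ⟨fun hx ↦ ⟨x.2, hx⟩, fun hx ↦ hx.2⟩

/-! ### Castella–Wan's Cor. 6.4 in kernel form, with `str = ker loc_𝔭` -/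

/-- **"`loc_𝔭(z)` is not `Λ^ac`-torsion"** for a family `z = (z_{n,m}) ∈ ∏_{n,m} H¹(K_n, E[p^m])` and a
generator `γ`: every `f ∈ ℤ_p⟦T⟧` with `loc (f ⋆ z) = 0` at every level (`f ⋆ z = tsmul … f z`, the
truncated action `T ↦ conj_γ − 1` of the sibling file) is `0`. For `z = z^ε_∞ ∈ Sel_ε(K, 𝐓^ac)` this is
the content of Castella–Wan's Cor. 6.4 used on MS p. 30 ("the non-vanishing of `loc_𝔭`" of the class
in the torsion-free rank-one `H¹_±(K_𝔭, 𝐓^ac)`), in Castella–Wan's sense `str = ker loc_𝔭`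
(`isLocNonTorsion_iff_loc`, `isLocNonTorsion_iff_smul_loc`). READING (flag `str-vs-loc-zero`): the
sibling predicate `IsLocNonTorsionAt` (the seat's Cor. 6.4 transfer file) phrases the
same sentence with the tree's `PCond.str` reading of the strict condition; the present one uses
`ker loc_𝔭`; the two are related exactly as the two strict conditions are (see `locKer`). A predicate
(definition with a body), used as hypothesis / conclusion shape by the port.
[cite: CastellaWan2023, Cor. 6.4 (MS p. 27) and (6.13) (MS p. 30)] -/
def IsLocNonTorsion (γ : absoluteGaloisGroup K)
    (z : Π n m : ℕ, W.torsionH1Over ((p : ℤ) ^ m) (κ.layerSubgroup n)) : Prop :=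
  ∀ f : IwasawaAlgebra p, (∀ n m, tsmul W p κ γ f z n m ∈ locKer W p κ ι h n m) → f = 0

/-- `IsLocNonTorsion` for `z ∈ Sel^{𝓒}` reads: `loc (f • z) = 0 → f = 0` for the CONSTRUCTED module
structure `lambdaAdic.moduleOfGen`. [cite: CastellaWan2023, Cor. 6.4 (MS p. 27) and (6.13) (MS p. 30)] -/
theorem isLocNonTorsion_iff_loc {γ : absoluteGaloisGroup K} {γE : absoluteGaloisGroup E}
    (hγE : κ (resGalOfEmb ι γE) = κ γ) (hγ : κ.IsTopGenerator γ)
    {C : ∀ n m : ℕ, AddSubgroup (W.torsionH1Over ((p : ℤ) ^ m) (κ.layerSubgroup n))}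
    (hC : ∀ n m, ∀ y ∈ C n m, conjH1 (κ.layerSubgroup n) (geomTorsion W ((p : ℤ) ^ m)) γ y ∈ C n m)
    (z : lambdaAdic W p κ γ C) :
    IsLocNonTorsion W p κ ι h γ z.1 ↔
      (letI := lambdaAdic.moduleOfGen hγ hC
       ∀ f : IwasawaAlgebra p, loc W p κ ι h γ γE hγE C (f • z) = 0 → f = 0) := by
  refine forall_congr' fun f ↦ ?_
  rw [loc_eq_zero_iff]
  exact Iff.rfl

/-- Equivalently (`Λ^ac`-linearity `loc_smul`): `f • loc z = 0 → f = 0` in the local module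
`H¹(K_v, 𝐓^ac)` — `loc z` is not a `Λ^ac`-torsion element. [cite: CastellaWan2023, Cor. 6.4 (MS p. 27) and (6.13) (MS p. 30)] -/
theorem isLocNonTorsion_iff_smul_loc {γ : absoluteGaloisGroup K} {γE : absoluteGaloisGroup E}
    (hγE : κ (resGalOfEmb ι γE) = κ γ) (hγ : κ.IsTopGenerator γ)
    {C : ∀ n m : ℕ, AddSubgroup (W.torsionH1Over ((p : ℤ) ^ m) (κ.layerSubgroup n))}
    (hC : ∀ n m, ∀ y ∈ C n m, conjH1 (κ.layerSubgroup n) (geomTorsion W ((p : ℤ) ^ m)) γ y ∈ C n m)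
    (z : lambdaAdic W p κ γ C) :
    IsLocNonTorsion W p κ ι h γ z.1 ↔
      (letI := localLambdaAdic.moduleOfGen (W.baseChange E) p (κ.localize ι h) γE
        (isTopGenerator_localize_of_apply_eq p κ ι h hγE hγ)
       ∀ f : IwasawaAlgebra p, f • loc W p κ ι h γ γE hγE C z = 0 → f = 0) := by
  rw [isLocNonTorsion_iff_loc W p κ ι h hγE hγ hC z]
  refine forall_congr' fun f ↦ ?_
  rw [loc_smul W p κ ι h hγE hγ hC f z]

end Loc

/-! ## Part 5. Number fields: `loc_v` on `Sel^{𝓛}(K, 𝐓^ac)` at a prime `v` with one prime of `K_∞` above it -/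

section NumberField

variable {K : Type u} [Field K] [NumberField K] (W : WeierstrassCurve K) (p : ℕ) [Fact p.Prime]
  (κ : ZpExtension K p)

/-- **`loc_v : Sel^{𝓛}(K, 𝐓^ac) → H¹(K_v, 𝐓^ac)`** (Castella–Wan's `loc_𝔭` of (6.12)/(6.13) for `v = 𝔭`,
and its twin for `v = 𝔭̄`): `loc` for `E = K_v`, `ι = closureEmb`, `h : IsNonsplitIn κ v` (one prime of
`K_∞` above `v`), on the compact Selmer module `selmerLambdaAdic W p κ γ L` of the sibling file, with
values in `localLambdaAdic (W ×_K K_v) p (localizeAt κ v hv) γ_v`. [cite: CastellaWan2023, (6.12)–(6.13) (MS p. 30 = journal p. 2624)] -/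
abbrev locAt (v : HeightOneSpectrum (𝓞 K)) (hv : IsNonsplitIn κ v) (γ : absoluteGaloisGroup K)
    (γv : absoluteGaloisGroup (v.adicCompletion K))
    (hγv : κ (resGalOfEmb (closureEmb (K := K) (v.adicCompletion K)) γv) = κ γ)
    (L : HeightOneSpectrum (𝓞 K) → PCond) :
    selmerLambdaAdic W p κ γ L →+
      localLambdaAdic (W.baseChange (v.adicCompletion K)) p (localizeAt κ v hv) γv :=
  loc W p κ (closureEmb (K := K) (v.adicCompletion K)) hv γ γv hγv fun n m ↦ selmerTorsion W p κ L n m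

/-- Components of `locAt`. [cite: CastellaWan2023, (6.12) (MS p. 30)] -/
theorem locAt_apply (v : HeightOneSpectrum (𝓞 K)) (hv : IsNonsplitIn κ v) {γ : absoluteGaloisGroup K}
    {γv : absoluteGaloisGroup (v.adicCompletion K)}
    (hγv : κ (resGalOfEmb (closureEmb (K := K) (v.adicCompletion K)) γv) = κ γ)
    (L : HeightOneSpectrum (𝓞 K) → PCond) (x : selmerLambdaAdic W p κ γ L) (n m : ℕ) :
    (locAt W p κ v hv γ γv hγv L x).1 n m =
      W.localTorsionResOfEmb (closureEmb (K := K) (v.adicCompletion K)) ((p : ℤ) ^ m)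
        (κ.layerSubgroup n) (x.1 n m) :=
  rfl

/-- A matching local generator exists at `v` (from `IsNonsplitIn`). [cite: HatleyLeiVigni2022, §3.1] -/
theorem exists_apply_resGalOfEmb_closureEmb_eq (v : HeightOneSpectrum (𝓞 K)) (hv : IsNonsplitIn κ v)
    (γ : absoluteGaloisGroup K) :
    ∃ γv : absoluteGaloisGroup (v.adicCompletion K),
      κ (resGalOfEmb (closureEmb (K := K) (v.adicCompletion K)) γv) = κ γ :=
  exists_apply_resGalOfEmb_eq p κ _ hv γ

/-- **`loc_v x = 0 ↔ x` is strict at `v` in the sense `loc = 0` at every level.**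
[cite: CastellaWan2023, (6.12)–(6.13) (MS p. 30 = journal p. 2624)] -/
theorem locAt_eq_zero_iff (v : HeightOneSpectrum (𝓞 K)) (hv : IsNonsplitIn κ v) {γ : absoluteGaloisGroup K}
    {γv : absoluteGaloisGroup (v.adicCompletion K)}
    (hγv : κ (resGalOfEmb (closureEmb (K := K) (v.adicCompletion K)) γv) = κ γ)
    (L : HeightOneSpectrum (𝓞 K) → PCond) (x : selmerLambdaAdic W p κ γ L) :
    locAt W p κ v hv γ γv hγv L x = 0 ↔
      ∀ n m, x.1 n m ∈ locKer W p κ (closureEmb (K := K) (v.adicCompletion K)) hv n m :=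
  loc_eq_zero_iff W p κ _ hv hγv _ x

end NumberField

end AcSigned

end Literature.NumberTheory.EllipticCurves
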